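import Mathlib
import Literature.Computability.AlgebraicComplexity.GroupTheoreticMatMul
import Summits.MatrixMultiplication.MatrixMultiplication.Theorems.GroupTheoreticSTPPCAbelianObstructionNegSecondMoment

/-!
# The index-two endgame (U11-Δ⁺) for STPP families in finite abelian groups, Kneser-free

Support file for route `MatrixMultiplication/GroupTheoreticSTPP`, negative crux
`stmt-MatrixMultiplication-0596` (`CAbelianObstructionNeg`), finite-range evidence; cell mm-stpp, rung F-M1.
Kernel form of the lit seat's rule U11-Δ⁺ (HOME/mm-stpp-lit/KNESER-KILLS.md §4.2), with the subgroup
structure supplied by the very-small-difference-set lemma of `…NegSecondMoment.lean` instead of Kneser's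
theorem.

Setting (C-form): STPP family `(A i, B i, C i)` with non-empty sets in a finite abelian group `H`,
`M = |H|`, `Y = ⋃ (B j − C j)`, `Z = ⋃ (A k − C k)`.
* Index-two bookkeeping for finsets `K` with `0 ∈ K`, `K − K ⊆ K`, `2|K| = M`: two elements outside `K`
  differ by an element of `K` (`sub_mem_of_not_mem_of_index_two`); two such finsets meet in at least half
  of either (`card_le_two_mul_card_inter`); hence two of their translates sharing a point meet in `≥ M/4`
  points (`card_le_two_mul_card_inter_vadd`).
* `endgame_C` (+ rotations `_A`, `_B`): if `2|Y − Y| = M`, `2|Y − Y| < 3|Y|` and likewise for `Z`, then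
  `4(Σbc + Σca) ≤ 3M + 4|C t|` for every member `t` (the cosets through `x₀ + Y` and `Z` share the point
  `s' − u'` and so `≥ M/4` points, while `|(x₀ + Y) ∪ Z| ≥ Σbc + Σca − |C t|`).
* `card_sub_eq_of_test`: the arithmetic test pinning `|X − X|` from the second-moment inequality and the
  divisor dichotomy; `false_of_endgame_C`: the resulting `decide`-able kill schema on shape data.
With `…NegSecondMoment.lean` this kills every leaf of the cell's vM shape sieve for `T_E` (`τ = 5/2`) at
every abelian order `≤ 149` (2 600 leaves at 128–149: 2 577 by the certificate, the remaining 23 by this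
endgame; instances in `AbelianSTPPCensusTELeavesKills.lean`).

WHAT THIS IS NOT: no `ω` statement; necessary conditions only; the leaf ENUMERATION (sieve completeness)
is not a kernel object.
-/

-- single-conjunct summit: the mandated namespace repeats `MatrixMultiplication`.
set_option linter.dupNamespace false

namespace Summit.MatrixMultiplication.MatrixMultiplication.Theorems

namespace STPPSlack

open Finset Literature.Computability.AlgebraicComplexity
open scoped Pointwise

variable {H : Type*} [AddCommGroup H] [DecidableEq H]

/-! ### Index-two bookkeeping for finsets closed under subtraction -/

/-- If `0 ∈ K`, `K` is closed under subtraction and `2|K| = |H|`, then any two elements outside `K`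
differ by an element of `K` (the complement of `K` is a single coset). [folklore] -/
theorem sub_mem_of_not_mem_of_index_two [Fintype H] {K : Finset H} (h0 : (0 : H) ∈ K)
    (hsub : ∀ a ∈ K, ∀ b ∈ K, a - b ∈ K) (hcard : 2 * K.card = Fintype.card H)
    {u₁ u₂ : H} (hu₁ : u₁ ∉ K) (hu₂ : u₂ ∉ K) : u₁ - u₂ ∈ K := by
  have hdisj : ∀ {u : H}, u ∉ K → Disjoint (u +ᵥ K) K := by
    intro u hu
    rw [disjoint_left]
    intro x hx hxK
    rw [mem_vadd_finset] at hx
    obtain ⟨k, hk, rfl⟩ := hx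
    have := hsub _ hxK _ hk
    rw [vadd_eq_add, add_sub_cancel_right] at this
    exact hu this
  have hsubset : ∀ {u : H}, u ∉ K → u +ᵥ K ⊆ univ \ K := fun hu =>
    subset_sdiff.2 ⟨subset_univ _, hdisj hu⟩
  have hcardc : (univ \ K).card = K.card := by
    rw [card_univ_sdiff]; omega
  have heq : ∀ {u : H}, u ∉ K → u +ᵥ K = univ \ K := fun hu =>
    eq_of_subset_of_card_le (hsubset hu) (by rw [hcardc, card_vadd_finset])
  have hmem : u₁ ∈ u₂ +ᵥ K := by
    rw [heq hu₂, ← heq hu₁, mem_vadd_finset]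
    exact ⟨0, h0, by rw [vadd_eq_add, add_zero]⟩
  rw [mem_vadd_finset] at hmem
  obtain ⟨k, hk, hk'⟩ := hmem
  rw [vadd_eq_add] at hk'
  rw [← hk', add_sub_cancel_left]
  exact hk

/-- A subtraction-closed finset `K₁` meets a subtraction-closed finset `K₂` of size `|H|/2` in at least
`|K₁|/2` elements (`K₁ ∖ K₂` injects into `K₁ ∩ K₂` by `u ↦ u − u₁`). [folklore] -/
theorem card_le_two_mul_card_inter [Fintype H] {K₁ K₂ : Finset H}
    (hsub₁ : ∀ a ∈ K₁, ∀ b ∈ K₁, a - b ∈ K₁) (h0₂ : (0 : H) ∈ K₂)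
    (hsub₂ : ∀ a ∈ K₂, ∀ b ∈ K₂, a - b ∈ K₂) (hc₂ : 2 * K₂.card = Fintype.card H) :
    K₁.card ≤ 2 * (K₁ ∩ K₂).card := by
  by_cases hsubset : K₁ ⊆ K₂
  · rw [inter_eq_left.2 hsubset]; omega
  · obtain ⟨u₁, hu₁K₁, hu₁K₂⟩ := not_subset.1 hsubset
    have hle : (K₁ \ K₂).card ≤ (K₁ ∩ K₂).card := by
      refine card_le_card_of_injOn (fun u => u - u₁) ?_ ?_
      · intro u hu
        rw [mem_coe, mem_sdiff] at hu
        rw [mem_coe, mem_inter]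
        exact ⟨hsub₁ _ hu.1 _ hu₁K₁, sub_mem_of_not_mem_of_index_two h0₂ hsub₂ hc₂ hu.2 hu₁K₂⟩
      · intro u _ v _ (huv : u - u₁ = v - u₁)
        exact sub_left_injective huv
    have := card_sdiff_add_card_inter K₁ K₂
    omega

/-- Re-centering a translate of a subtraction-closed finset at any of its elements. [folklore] -/
theorem vadd_eq_vadd_of_mem {K : Finset H} (h0 : (0 : H) ∈ K) (hsub : ∀ a ∈ K, ∀ b ∈ K, a - b ∈ K)
    {p w : H} (hw : w ∈ p +ᵥ K) : p +ᵥ K = w +ᵥ K := by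
  rw [mem_vadd_finset] at hw
  obtain ⟨k₀, hk₀, rfl⟩ := hw
  ext x
  simp only [mem_vadd_finset, vadd_eq_add]
  constructor
  · rintro ⟨k, hk, rfl⟩
    exact ⟨k - k₀, hsub _ hk _ hk₀, by abel⟩
  · rintro ⟨k, hk, rfl⟩
    have h1 : 0 - k ∈ K := hsub _ h0 _ hk
    have h2 : k₀ - (0 - k) ∈ K := hsub _ hk₀ _ h1
    refine ⟨k₀ - (0 - k), h2, by abel⟩

/-- Two translates of subtraction-closed finsets, the second of size `|H|/2`, that share a point `w` meet
in at least `|K₁|/2` points. [folklore] -/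
theorem card_le_two_mul_card_inter_vadd [Fintype H] {K₁ K₂ : Finset H} (h0₁ : (0 : H) ∈ K₁)
    (h0₂ : (0 : H) ∈ K₂) (hsub₁ : ∀ a ∈ K₁, ∀ b ∈ K₁, a - b ∈ K₁)
    (hsub₂ : ∀ a ∈ K₂, ∀ b ∈ K₂, a - b ∈ K₂) (hc₂ : 2 * K₂.card = Fintype.card H) {p q w : H}
    (hw₁ : w ∈ p +ᵥ K₁) (hw₂ : w ∈ q +ᵥ K₂) : K₁.card ≤ 2 * ((p +ᵥ K₁) ∩ (q +ᵥ K₂)).card := by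
  rw [vadd_eq_vadd_of_mem h0₁ hsub₁ hw₁, vadd_eq_vadd_of_mem h0₂ hsub₂ hw₂, ← vadd_finset_inter,
    card_vadd_finset]
  exact card_le_two_mul_card_inter hsub₁ h0₂ hsub₂ hc₂

/-! ### The index-two endgame (U11-Δ⁺, kernel form) -/

variable {N : ℕ} {A B C : Fin N → Finset H}

/-- **Index-two endgame (`C`-form).** For an STPP family with all sets non-empty in a finite abelian group
`H`, `M = |H|`: if `Y = ⋃ (B j − C j)` and `Z = ⋃ (A k − C k)` both lie in cosets of index-2 subgroups —
stated as `2|Y − Y| = M`, `2|Y − Y| < 3|Y|` (so `Y − Y` is a subgroup, `Y ⊆ y₀ + (Y − Y)`), and likewise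
for `Z` — then `4(Σbc + Σca) ≤ 3M + 4|C t|` for every member `t`: for `x₀ = s' − t' ∈ A t − B t` the two
cosets containing `x₀ + Y` and `Z` share the point `s' − u'` (`u' ∈ C t`), hence at least `M/4` points, so
`|(x₀ + Y) ∪ Z| ≤ 3M/4`, while `|(x₀ + Y) ∪ Z| ≥ Σbc + Σca − |C t|`. (The lit seat's U11-Δ⁺ endgame,
HOME/mm-stpp-lit/KNESER-KILLS.md §4.2, Kneser-free.) [original] -/
theorem endgame_C [Fintype H] (h : IsSTPP A B C) (hA : ∀ i, (A i).Nonempty)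
    (hB : ∀ i, (B i).Nonempty) (hC : ∀ i, (C i).Nonempty)
    (hY2 : 2 * ((univ.biUnion fun j => B j - C j) - univ.biUnion fun j => B j - C j).card =
      Fintype.card H)
    (hY3 : 2 * ((univ.biUnion fun j => B j - C j) - univ.biUnion fun j => B j - C j).card <
      3 * ∑ i, (B i).card * (C i).card)
    (hZ2 : 2 * ((univ.biUnion fun k => A k - C k) - univ.biUnion fun k => A k - C k).card =
      Fintype.card H)
    (hZ3 : 2 * ((univ.biUnion fun k => A k - C k) - univ.biUnion fun k => A k - C k).card <
      3 * ∑ i, (A i).card * (C i).card) (t : Fin N) :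
    4 * (∑ i, (B i).card * (C i).card + ∑ i, (A i).card * (C i).card) ≤
      3 * Fintype.card H + 4 * (C t).card := by
  set Y := univ.biUnion fun j => B j - C j with hYdef
  set Z := univ.biUnion fun k => A k - C k with hZdef
  have hYcard : Y.card = ∑ i, (B i).card * (C i).card := card_Y h hA
  have hZcard : Z.card = ∑ i, (A i).card * (C i).card := card_Z h hB
  obtain ⟨s', hs'⟩ := hA t
  obtain ⟨t', ht'⟩ := hB t
  obtain ⟨u', hu'⟩ := hC t
  have hyY : t' - u' ∈ Y := by rw [hYdef, mem_biUnion]; exact ⟨t, mem_univ _, sub_mem_sub ht' hu'⟩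
  have hzZ : s' - u' ∈ Z := by rw [hZdef, mem_biUnion]; exact ⟨t, mem_univ _, sub_mem_sub hs' hu'⟩
  -- `Y − Y`, `Z − Z` are subtraction-closed and contain 0
  have hKYsub : ∀ a ∈ Y - Y, ∀ b ∈ Y - Y, a - b ∈ Y - Y := fun a ha b hb =>
    sub_mem_sub_of_small (by rw [hYcard]; exact hY3) ha hb
  have hKZsub : ∀ a ∈ Z - Z, ∀ b ∈ Z - Z, a - b ∈ Z - Z := fun a ha b hb =>
    sub_mem_sub_of_small (by rw [hZcard]; exact hZ3) ha hb
  have h0Y : (0 : H) ∈ Y - Y := by simpa using sub_mem_sub hyY hyY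
  have h0Z : (0 : H) ∈ Z - Z := by simpa using sub_mem_sub hzZ hzZ
  -- `x₀ + Y ⊆ P` and `Z ⊆ Q`, cosets of `Y − Y`, `Z − Z` through the common point `s' − u'`
  set P := ((s' - t') + (t' - u')) +ᵥ (Y - Y) with hPdef
  set Q := (s' - u') +ᵥ (Z - Z) with hQdef
  have hYP : (s' - t') +ᵥ Y ⊆ P := by
    intro e he
    rw [mem_vadd_finset] at he
    obtain ⟨y, hy, rfl⟩ := he
    rw [hPdef, mem_vadd_finset]
    exact ⟨y - (t' - u'), sub_mem_sub hy hyY, by rw [vadd_eq_add, vadd_eq_add]; abel⟩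
  have hZQ : Z ⊆ Q := by
    intro z hz
    rw [hQdef, mem_vadd_finset]
    exact ⟨z - (s' - u'), sub_mem_sub hz hzZ, by rw [vadd_eq_add]; abel⟩
  have hw₁ : s' - u' ∈ P := hYP (mem_vadd_finset.2 ⟨t' - u', hyY, by rw [vadd_eq_add]; abel⟩)
  have hw₂ : s' - u' ∈ Q := hZQ hzZ
  have hbig := card_le_two_mul_card_inter_vadd h0Y h0Z hKYsub hKZsub hZ2 hw₁ hw₂
  have hPc : P.card = (Y - Y).card := by rw [hPdef, card_vadd_finset]
  have hQc : Q.card = (Z - Z).card := by rw [hQdef, card_vadd_finset]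
  have hPQ := card_union_add_card_inter P Q
  have hUle : (((s' - t') +ᵥ Y) ∪ Z).card ≤ (P ∪ Q).card :=
    card_le_card (union_subset_union hYP hZQ)
  have hUI := card_union_add_card_inter ((s' - t') +ᵥ Y) Z
  rw [card_vadd_finset, hYcard, hZcard] at hUI
  have hsmall : (((s' - t') +ᵥ Y) ∩ Z).card ≤ (C t).card :=
    (card_le_card (vadd_Y_inter_Z_subset h hs' ht')).trans card_image_le
  rw [← hPdef, ← hQdef] at hbig
  omega

/-- **Index-two endgame, `A`-form** (rotation `(B, C, A)`): cosets `⋃ (C − A)`, `⋃ (B − A)`;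
`4(Σca + Σab) ≤ 3M + 4|A t|`. [original] -/
theorem endgame_A [Fintype H] (h : IsSTPP A B C) (hA : ∀ i, (A i).Nonempty)
    (hB : ∀ i, (B i).Nonempty) (hC : ∀ i, (C i).Nonempty)
    (hY2 : 2 * ((univ.biUnion fun j => C j - A j) - univ.biUnion fun j => C j - A j).card =
      Fintype.card H)
    (hY3 : 2 * ((univ.biUnion fun j => C j - A j) - univ.biUnion fun j => C j - A j).card <
      3 * ∑ i, (C i).card * (A i).card)
    (hZ2 : 2 * ((univ.biUnion fun k => B k - A k) - univ.biUnion fun k => B k - A k).card =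
      Fintype.card H)
    (hZ3 : 2 * ((univ.biUnion fun k => B k - A k) - univ.biUnion fun k => B k - A k).card <
      3 * ∑ i, (B i).card * (A i).card) (t : Fin N) :
    4 * (∑ i, (C i).card * (A i).card + ∑ i, (B i).card * (A i).card) ≤
      3 * Fintype.card H + 4 * (A t).card :=
  endgame_C h.rotate hB hC hA hY2 hY3 hZ2 hZ3 t

/-- **Index-two endgame, `B`-form** (rotation `(C, A, B)`): cosets `⋃ (A − B)`, `⋃ (C − B)`;
`4(Σab + Σcb) ≤ 3M + 4|B t|`. [original] -/
theorem endgame_B [Fintype H] (h : IsSTPP A B C) (hA : ∀ i, (A i).Nonempty)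
    (hB : ∀ i, (B i).Nonempty) (hC : ∀ i, (C i).Nonempty)
    (hY2 : 2 * ((univ.biUnion fun j => A j - B j) - univ.biUnion fun j => A j - B j).card =
      Fintype.card H)
    (hY3 : 2 * ((univ.biUnion fun j => A j - B j) - univ.biUnion fun j => A j - B j).card <
      3 * ∑ i, (A i).card * (B i).card)
    (hZ2 : 2 * ((univ.biUnion fun k => C k - B k) - univ.biUnion fun k => C k - B k).card =
      Fintype.card H)
    (hZ3 : 2 * ((univ.biUnion fun k => C k - B k) - univ.biUnion fun k => C k - B k).card <
      3 * ∑ i, (C i).card * (B i).card) (t : Fin N) :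
    4 * (∑ i, (A i).card * (B i).card + ∑ i, (C i).card * (B i).card) ≤
      3 * Fintype.card H + 4 * (B t).card :=
  endgame_C h.rotate.rotate hC hA hB hY2 hY3 hZ2 hZ3 t

/-! ### Tools for the instances: orientation swap and the arithmetic test for `|X − X| = |X|` -/

omit [DecidableEq H] in
/-- `(⋃ (P k − Q k)) − (⋃ (P k − Q k))` is symmetric under swapping `P` and `Q`. [folklore] -/
theorem biUnion_sub_sub_swap [DecidableEq H] (P Q : Fin N → Finset H) :
    ((univ.biUnion fun k => P k - Q k) - univ.biUnion fun k => P k - Q k) =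
      ((univ.biUnion fun k => Q k - P k) - univ.biUnion fun k => Q k - P k) := by
  have key : ∀ (P Q : Fin N → Finset H),
      ((univ.biUnion fun k => P k - Q k) - univ.biUnion fun k => P k - Q k) ⊆
        ((univ.biUnion fun k => Q k - P k) - univ.biUnion fun k => Q k - P k) := by
    intro P Q x hx
    rw [mem_sub] at hx
    obtain ⟨d, hd, e, he, rfl⟩ := hx
    rw [mem_biUnion] at hd he
    obtain ⟨k, -, hd⟩ := hd
    obtain ⟨l, -, he⟩ := he
    rw [mem_sub] at hd he
    obtain ⟨p, hp, q, hq, rfl⟩ := hd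
    obtain ⟨p', hp', q', hq', rfl⟩ := he
    have : (p - q) - (p' - q') = (q' - p') - (q - p) := by abel
    rw [this]
    exact sub_mem_sub (mem_biUnion.2 ⟨l, mem_univ _, sub_mem_sub hq' hp'⟩)
      (mem_biUnion.2 ⟨k, mem_univ _, sub_mem_sub hq hp⟩)
  exact Subset.antisymm (key P Q) (key Q P)

/-- **Arithmetic test pinning `|X − X|`.** If `|X| = S`, `|H| = M`, the second-moment inequality
`T + (|X − X| − 1)L ≤ T₂` holds, and every `D ∈ [S, M]` with `3S ≤ 2D ∨ D ∣ M` and `T + (D − 1)L ≤ T₂`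
equals `D₀`, then `|X − X| = D₀`. [original] -/
theorem card_sub_eq_of_test [Fintype H] {X : Finset H} (hX : X.Nonempty) {S M T L T₂ D₀ : ℕ}
    (hM : Fintype.card H = M) (hS : X.card = S) (hineq : T + ((X - X).card - 1) * L ≤ T₂)
    (htest : ∀ D ∈ Finset.Icc S M, (3 * S ≤ 2 * D ∨ D ∣ M) → T + (D - 1) * L ≤ T₂ → D = D₀) :
    (X - X).card = D₀ := by
  obtain ⟨x, hx⟩ := hX
  have h1 : X.card ≤ (X - X).card := by
    rw [← card_vadd_finset (-x) X]
    refine card_le_card fun e he => ?_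
    rw [mem_vadd_finset] at he
    obtain ⟨x', hx', rfl⟩ := he
    rw [vadd_eq_add, neg_add_eq_sub]
    exact sub_mem_sub hx' hx
  have h2 : (X - X).card ≤ Fintype.card H := card_le_univ _
  have h3 : 3 * X.card ≤ 2 * (X - X).card ∨ (X - X).card ∣ Fintype.card H := by
    by_cases hsmall : 2 * (X - X).card < 3 * X.card
    · exact Or.inr (card_sub_dvd_card ⟨x, hx⟩ hsmall)
    · left; omega
  rw [hS] at h1 h3; rw [hM] at h2 h3
  exact htest _ (mem_Icc.2 ⟨h1, h2⟩) h3 hineq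

omit [DecidableEq H] in
/-- **Endgame kill schema (`C`-form).** Shape data `(a, b, c)` of an STPP family with positive sizes in
an abelian group of order `M`; `m_A ≥` all `a r`, `m_B ≥` all `b r`.  If the `A`-form second-moment test
pins `|Y − Y| = D_Y` and the `B`-form test pins `|Z − Z| = D_Z` with `2D_Y = 2D_Z = M`, `2D_Y < 3Σbc`,
`2D_Z < 3Σca`, and `4(Σbc + Σca) > 3M + 4·c t` for some member `t`, the family does not exist. [original] -/
theorem false_of_endgame_C [Fintype H] {k : ℕ} {A B C : Fin k → Finset H} (h : IsSTPP A B C)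
    {a b c : Fin k → ℕ} (hA : ∀ r, (A r).card = a r) (hB : ∀ r, (B r).card = b r)
    (hC : ∀ r, (C r).card = c r) (hpos : ∀ r, 0 < a r ∧ 0 < b r ∧ 0 < c r)
    {M mA mB Sab Sbc Sca Sba Scb DY DZ : ℕ} (hM : Fintype.card H = M)
    (hmA : ∀ r, a r ≤ mA) (hmB : ∀ r, b r ≤ mB)
    (hab : ∑ r, a r * b r = Sab) (hbc : ∑ r, b r * c r = Sbc) (hca : ∑ r, c r * a r = Sca)
    (hac : ∑ r, a r * c r = Sca) (hba : ∑ r, b r * a r = Sba) (hcb : ∑ r, c r * b r = Scb)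
    (htestY : ∀ D ∈ Finset.Icc Sbc M, (3 * Sbc ≤ 2 * D ∨ D ∣ M) →
      Sca + (D - 1) * (2 * Sca + Sba - (M + 2 * mA)) ≤ Sca * Sca → D = DY)
    (htestZ : ∀ D ∈ Finset.Icc Sca M, (3 * Sca ≤ 2 * D ∨ D ∣ M) →
      Sab + (D - 1) * (2 * Sab + Scb - (M + 2 * mB)) ≤ Sab * Sab → D = DZ)
    (hDY : 2 * DY = M) (hDY3 : 2 * DY < 3 * Sbc) (hDZ : 2 * DZ = M) (hDZ3 : 2 * DZ < 3 * Sca)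
    (t : Fin k) (ht : 3 * M + 4 * c t < 4 * (Sbc + Sca)) : False := by
  classical
  have hA' : ∀ r, (A r).Nonempty := fun r => card_pos.1 (by rw [hA r]; exact (hpos r).1)
  have hB' : ∀ r, (B r).Nonempty := fun r => card_pos.1 (by rw [hB r]; exact (hpos r).2.1)
  have hC' : ∀ r, (C r).Nonempty := fun r => card_pos.1 (by rw [hC r]; exact (hpos r).2.2)
  have hmA' : ∀ r, (A r).card ≤ mA := fun r => by rw [hA r]; exact hmA r
  have hmB' : ∀ r, (B r).card ≤ mB := fun r => by rw [hB r]; exact hmB r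
  rcases isEmpty_or_nonempty (Fin k) with hk | ⟨⟨r₀⟩⟩
  · exact (IsEmpty.false t).elim
  -- Y-test via the A-form second moment
  have smY := second_moment_C h.rotate hB' hC' hmA'
  have hYcard : (univ.biUnion fun i => B i - C i).card = Sbc := by
    rw [card_Y h hA']; simp only [hB, hC, hbc]
  have hYne : (univ.biUnion fun i => B i - C i).Nonempty := by
    rw [← card_pos, hYcard, ← hbc]
    exact lt_of_lt_of_le (Nat.mul_pos (hpos r₀).2.1 (hpos r₀).2.2)
      (single_le_sum (f := fun r => b r * c r) (fun _ _ => Nat.zero_le _) (mem_univ r₀))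
  simp only [hA, hB, hC, hca, hba, hM] at smY
  have hYD := card_sub_eq_of_test hYne hM hYcard smY htestY
  -- Z-test via the B-form second moment and the orientation swap
  have smZ := second_moment_C h.rotate.rotate hC' hA' hmB'
  rw [biUnion_sub_sub_swap C A] at smZ
  have hZcard : (univ.biUnion fun i => A i - C i).card = Sca := by
    rw [card_Z h hB']; simp only [hA, hC, hac]
  have hZne : (univ.biUnion fun i => A i - C i).Nonempty := by
    rw [← card_pos, hZcard, ← hac]
    exact lt_of_lt_of_le (Nat.mul_pos (hpos r₀).1 (hpos r₀).2.2)
      (single_le_sum (f := fun r => a r * c r) (fun _ _ => Nat.zero_le _) (mem_univ r₀))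
  simp only [hA, hB, hC, hab, hcb, hM] at smZ
  have hZD := card_sub_eq_of_test hZne hM hZcard smZ htestZ
  -- endgame
  have key := endgame_C h hA' hB' hC' (by rw [hYD, hDY, hM]) (by
      rw [hYD]; simp only [hB, hC, hbc]; exact hDY3) (by rw [hZD, hDZ, hM]) (by
      rw [hZD]; simp only [hA, hC, hac]; exact hDZ3) t
  simp only [hA, hB, hC, hbc, hac, hM] at key
  omega

end STPPSlack

end Summit.MatrixMultiplication.MatrixMultiplication.Theorems
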